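import Literature.MathematicalPhysics.QuantumFieldTheory.Balaban1983to89.B9LettersZQstarFieldsAtPins
import Literature.MathematicalPhysics.QuantumFieldTheory.Balaban1983to89.B9SupLettersFromClassLetters
import Literature.MathematicalPhysics.QuantumFieldTheory.Balaban1983to89.B9Eq3126HTransposeCoords
import Literature.MathematicalPhysics.QuantumFieldTheory.Balaban1983to89.B9Eq3132ClassLetterFromNu

/-!
# `Balaban1983to89.B9LettersZCFieldsAtPins` — [B9] Thms 3.12–3.13 (pp. 420–426), (3.132) p. 422: THE `C = (QGQ*)⁻¹`- AND `C₁ = (QG₁Q*)⁻¹`-LETTER FIELDS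
# OF THE ROWS-20–21 Z-SCHEMAS AT THE N06 CERTIFICATE'S PINS — `LettersHZ.c2 ∕ c12` from row 26's ν-reading (dag-n06-i's bridge), `Letters313Z(c).c1_1` and
# the block-L² `Letters313L2PZ(c).c1` from `.c1_2 = c12` (p. 398 transfer ∕ Schur), and the counting self-transpose of node00-def-Y's model `C1coK`

T. Bałaban, *Propagators for lattice gauge theories in a background field*, Commun. Math. Phys. **99** (1985) 389–434 [`Balaban1985BackgroundPropagators`,
"B9"]; [4] = T. Bałaban, *Propagators and renormalization transformations for lattice gauge theories. II*, Commun. Math. Phys. **96** (1984) 223–250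
[`Balaban1984PropagatorsII`].  statement-level skeleton of published theorems with citation tags; proofs where landed; nothing here is a claim about the
Yang–Mills mass gap.

THE PRINT.  (3.132) p. 422: *"|(QGQ\*)⁻¹(y, y′)|, |(QG₁Q\*)⁻¹(y, y′)| ≦ O(1)(Lʲη)⁻²(L^{j′}η)^{−d} e^{−δ₁d(y,y′)}"*; p. 398 (remark after (3.47)): *"we can transfer
these powers from one side to another"*; (3.46) p. 398 (block-L² lines); p. 391 (the L² adjoints).  In the rows-20–21 schemas (dag-n06-l `LettersHZ`,
`Letters313Z`∕`Zc`, `Letters313L2PZ`∕`L2Pc`) these two letters fill SIX displayed fields: `LettersHZ.c2` (`C : 𝔠_Z⁽²⁾ → Z_{n⁻¹}`), `LettersHZ.c12` =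
`Letters313Z(c).c1_2` (`C₁ : 𝔠_Z⁽²⁾ → Z_{n⁻¹}`), `Letters313Z(c).c1_1` (`C₁ : 𝔠_Z⁽¹⁾ → Z_{len·n⁻¹}`), `Letters313L2PZ(c).c1` (block-L², weights `(√n⁻¹·len)⁻¹ ⊗ (…)⁻¹`).

THE POINT (cell `pub-ymgap`, node N06 [B9]; width seat w5, piece (o5) of the w5 lineage; parent = dag-n06-i `B9Eq3132ClassLetterFromNu`, p638273).
* §1 ★ `hasMaj_shift_weight_target` (p. 398's transfer for a weighted coarse TARGET — mirror of dag-n06-l's `B9Thm313WholeQstarFromG0.hasMaj_shift_weight`;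
  [4] (2.60) as the member facts `Facts347`) · ★★ `c1_1_of_c1_2` (`Letters313Z(c).c1_1` from `.c1_2`: constant `×L₀`, rate loss `αδ`);
* §2 ★ `hasMajorantHom_raw_of_hasMaj_cNorm_weightNorm` (a class majorant `𝔠⁽ᵖ⁾ → Z_W` READ as the two-variable [4]-(2.51) kernel `K(a,b)·W(a)⁻¹·(L^{j′}η)_b^{−p}`,
  no transfer — dag-n06-w8's `B9SupLettersFromClassLetters.hasMajorantHom_of_hasMaj_cNorm_weightNorm` is the transferred one-variable form) · ★★ `c1_l2_of_c1_2`
  (the block-L² `Letters313L2PZ(c).c1` at `vZ = √wZ` from `.c1_2` + `IsTransposePair C₁ C₁` by SCHUR (`B9RWSums346Schur.blockBd_schur`): SAME constant, SAME rate);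
* §3 ★ `isTransposePair_C1coK` (def-Y's `C1coK … Gp Δ2 U` is its own counting-transpose at a `U(N)`-valued `U` with trace-symmetric `G₁(U)` — twin of dag-n06-w8's
  `B9Eq3126HTransposeCoords.isTransposePair_CcoK`) · ★★ `c1_l2_pins` (§2 at a member; pin `hC1 = hC1co12`, the certificate's `hΔ2`; `c1_1` at a member = `c1_1_of_c1_2` at `geo9Y x` verbatim);
* §4 ★★ `c2_pins` ∕ `c12_pins` (`LettersHZ.c2 ∕ c12` at the pins `hCco12 ∕ hC1co12 ∕ hblkZ12` from row 26's per-member `Ineq3132` conjuncts, prescribed `δ₃ < δ₁`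
  above the threshold `2 log L ≤ (δ₁−δ₃)(2L²−1)M`) · ★★★ `c2_c12_pins_of_row26` (BOTH letters, `∃ M₄ δ₃ a₀ B₃`, from row 26's `Stmt3132Printed` EXACTLY as the
  certificate holds it at `opsYNuOfRecordV4PE` — one `obtain` for the knit).
NET for the knit (dag-n06-d's call, no edition asked): with dag-n06-w5 g3's `gQs2_pins ∕ dgQs_pins` (p634692) the binder `hlettersH12 : LettersHZ …` is derivable
WHOLE from row 26 + the G₀ layer + the pins; `hletters13.c1_2 ∕ c1_1` and `hLL2.1.c1` likewise (§1–§4).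

HONEST SCOPE.  Class ∕ weight bookkeeping, Schur row–column sums, def-Y's trace dictionary and dag-n06-i's bridge over landed modules; the (3.132) kernels
(`h26`, row 26's content) and the letter `c1_2` are HYPOTHESES where used; nothing of [B9]'s (3.132) or Theorems 3.12 ∕ 3.13 is asserted; COUNT-NEUTRAL; N06 is
NOT discharged; one finite lattice at a time; nothing continuum, nothing about the mass gap ∕ Clay.  Cell `pub-ymgap` (HUMAN RULING D-0062 ∕ D-0154), Track A
node N06 [B9], width seat `pub-ymgap-dag-n06-w5` (g4), 2026-08-28.  A NEW file; nothing landed is modified.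
-/

noncomputable section

namespace Literature.MathematicalPhysics.QuantumFieldTheory.Balaban1983to89.B9LettersZCFieldsAtPins

open scoped Matrix.Norms.L2Operator
open Node00 B6GlobalChartV1 B6KLevelCensusIndexV1
open B6RandomWalk (HasMajorant BlockSupp)
open B6RandomWalkHom (HasMajorantHom)
open B7Prop2SpecialUnitary (specialUnitaryUnits specialUnitaryUnits_le_unitaryUnits)
open B9PinMembersKLevelV1 (MemberY geo9Y bg9Y)
open B6Ineq2142KLevelV1 (β lvl)
open B9CoReadingCoordsTranspose (TrIdx trBasis trBasis_repr_eq_trace isTransposePair_coordOpK_of_isSymmTr)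
open B9CoReadingCoordsH (XHK blkHK)
open B9GeoNormsKLevelV1 (geo9K geo9K_dist_nonneg)
open B9GeoLemma21KLevelV1 (geo9Y_dist_triangle geo9Y_dist_comm geo9Y_len_pos)
open B9Thm34Ext (toB6)
open B9SectDSup (weightNorm weightNorm_loc)
open B9SectDL2Decay (BlockBd bl2 bl2_nonneg)
open B11SectG (HasMaj BlockNorm)
open B9Thm312Whole (Ops GeoOK cNorm wt wt_pos wt_nonneg)
open B9Thm312WholeClasses (cNormR cNormR_loc cNormR_loc_neg_natCast)
open B9Thm37Glue (IsTransposePair)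
open B9Thm37GlueTorusCov (isTransposePair_smul)
open B9Thm37AllNormsInstances (abs_apply_le_ofBlocks_loc ofBlocks_loc_le_of_blockSupp)
open B9Thm311ReadingCoords (IsSymmTr)
open B9Thm311AdjointPairs (isAdjTr_QY_QsY_parBY)
open B9RWSums343to347Whole (Facts347)
open B9RWSums346Schur (blockBd_schur scaleTransfer_len_rpow)
open B9PerturbationMajorantAlgebra (hasMaj_weaken)
open Node00.OpsYSectDCoords (CcoK C1coK)
open B9Eq3132SectDLetters (GDY QGQinvY)
open B9Eq3132NuReading (siteKernelOfOpNu nuY)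
open B9Eq3132ClassLetterFromNu (hasMaj_cNorm_weightNorm_coordOpK_geo9Y_of_ineq3132Nu hasMaj_cNorm_weightNorm_coordOpK_of_stmt3132Nu)
open B9Thm39ReadingCoords (cR39 cR39_nonneg coordBound39 basisBound39 abs_repr_le)

/-! ## §1 p. 398's transfer for a weighted coarse TARGET; `c1_1` from `c1_2` -/

section Schema

variable {g : B9.Geometry} {X V Z : Type} [Fintype X] [Fintype V] [Fintype Z] [Fintype g.Site]
variable {R₀ : ℝ} {H₀ : Prop}

omit [Fintype X] in
/-- ★ **p. 398's TRANSFER FOR A WEIGHTED COARSE TARGET** (mirror of dag-n06-l's `B9Thm313WholeQstarFromG0.hasMaj_shift_weight`): a majorant `C·e^{−rd}` of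
`T : 𝔠^{(s)} → Z_w` is the majorant `C·L₀·e^{−(r−αδ)d}` of `T : 𝔠^{(s+1)} → Z_{len·w}` — the ratio `Lʲη∕L^{j′}η` costs `L₀·e^{αδd}` ([4] (2.60) as the member
facts `Facts347`). [cite: Balaban1985BackgroundPropagators, p.398 (remark after (3.47)); Balaban1984PropagatorsII, Lemma 2.1 (2.60) p.234] -/
theorem hasMaj_shift_weight_target (hG : GeoOK g) {dF : ℕ} {δ α L₀ : ℝ} (hF : Facts347 g R₀ H₀ dF δ α L₀) {blkV : V → g.Site}
    {blkZ : Z → g.Site} {w : g.Site → ℝ} (hw : ∀ y, 0 ≤ w y) (hw' : ∀ y, 0 ≤ g.len y * w y) {T : (V → ℝ) →ₗ[ℝ] (Z → ℝ)} {C r s : ℝ}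
    (hC : 0 ≤ C)
    (h : HasMaj (cNormR R₀ H₀ blkV hG.lenle s) (weightNorm (BlockNorm.ofBlocks (toB6 g R₀ H₀) blkZ) w hw) T
      (fun a b => C * Real.exp (-(r * g.dist a b)))) :
    HasMaj (cNormR R₀ H₀ blkV hG.lenle (s + 1)) (weightNorm (BlockNorm.ofBlocks (toB6 g R₀ H₀) blkZ) (fun y => g.len y * w y) hw') T
      (fun a b => C * L₀ * Real.exp (-((r - α * δ) * g.dist a b))) := by
  intro y' μ hμ y
  have hb := h y' μ hμ y
  simp only [weightNorm_loc, cNormR_loc] at hb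
  simp only [weightNorm_loc, cNormR_loc]
  rw [Real.rpow_add (hG.lenpos y'), Real.rpow_one]
  set N := (BlockNorm.ofBlocks (toB6 g R₀ H₀) blkZ).loc y (T μ) with hN
  set N' := (BlockNorm.ofBlocks (toB6 g R₀ H₀) blkV).loc y' μ with hN'
  have hN'0 : 0 ≤ N' := (BlockNorm.ofBlocks (toB6 g R₀ H₀) blkV).loc_nonneg y' μ
  have hsN : 0 ≤ g.len y' ^ s * N' := mul_nonneg (Real.rpow_nonneg (hG.lenle y') s) hN'0
  -- the transfer at (y′, y): e^{−αδd(y,y′)}·Lʲη ≦ L₀·L^{j′}η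
  have hst : Real.exp (-(α * δ * g.dist y y')) * g.len y ≤ L₀ * g.len y' := by
    have h1 : Real.exp (-(α * δ * g.dist y y')) * g.len y ^ (1 : ℝ) ≤ g.L ^ |(1 : ℝ)| * g.len y' ^ (1 : ℝ) := by
      have h := scaleTransfer_len_rpow hF 1 (by norm_num) y' y
      rw [hG.symm y' y] at h
      exact h
    rw [Real.rpow_one, Real.rpow_one, abs_one, Real.rpow_one] at h1
    exact h1.trans (mul_le_mul_of_nonneg_right hF.L_le (hG.lenle y'))
  have hsplit : Real.exp (-(r * g.dist y y')) =
      Real.exp (-((r - α * δ) * g.dist y y')) * Real.exp (-(α * δ * g.dist y y')) := by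
    rw [← Real.exp_add]; congr 1; ring
  have hE : 0 ≤ C * Real.exp (-((r - α * δ) * g.dist y y')) := mul_nonneg hC (Real.exp_nonneg _)
  calc g.len y * w y * N = g.len y * (w y * N) := by ring
    _ ≤ g.len y * (C * Real.exp (-(r * g.dist y y')) * (g.len y' ^ s * N')) := mul_le_mul_of_nonneg_left hb (hG.lenle y)
    _ = C * Real.exp (-((r - α * δ) * g.dist y y')) * (Real.exp (-(α * δ * g.dist y y')) * g.len y) * (g.len y' ^ s * N') := by
        rw [hsplit]; ring
    _ ≤ C * Real.exp (-((r - α * δ) * g.dist y y')) * (L₀ * g.len y') * (g.len y' ^ s * N') :=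
        mul_le_mul_of_nonneg_right (mul_le_mul_of_nonneg_left hst hE) hsN
    _ = C * L₀ * Real.exp (-((r - α * δ) * g.dist y y')) * (g.len y' ^ s * g.len y' * N') := by ring

omit [Fintype X] in
/-- ★★ **`Letters313Z(c).c1_1` FROM `.c1_2`** — `C₁ : 𝔠_Z⁽¹⁾ → Z_{len·wZ}` with `B₃·L₀·e^{−(δ₃−αδ)d}` from `C₁ : 𝔠_Z⁽²⁾ → Z_{wZ}` with `B₃·e^{−δ₃d}`
(= `LettersHZ.c12`'s shape at `bZ = Z_{wZ}`): one p. 398 transfer (`hasMaj_shift_weight_target` at `s = −2`); any `B₃′ ≥ B₃·L₀`, `δ₃′ ≤ δ₃ − αδ`; the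
schema field VERBATIM over an abstract letter `Cop` and block map `blkZ` (serves `Letters313Z` and its re-cut `Letters313Zc`, any weight `wZ > 0`).
[cite: Balaban1985BackgroundPropagators, (3.132) p.422 + Thm 3.13 p.426 + p.398 (remark after (3.47)); Balaban1984PropagatorsII, (2.51) p.232 + Lemma 2.1 (2.60) p.234] -/
theorem c1_1_of_c1_2 (hG : GeoOK g) {dF : ℕ} {δ α L₀ : ℝ} (hF : Facts347 g R₀ H₀ dF δ α L₀) {blkZ : Z → g.Site}
    {wZ : g.Site → ℝ} (hwZ : ∀ y, 0 < wZ y) (hwZ' : ∀ y, 0 ≤ g.len y * wZ y) {Cop : Module.End ℝ (Z → ℝ)} {B₃ δ₃ B₃' δ₃' : ℝ}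
    (hB₃ : 0 ≤ B₃) (hB' : B₃ * L₀ ≤ B₃') (hδ' : δ₃' ≤ δ₃ - α * δ)
    (h : HasMaj (cNorm R₀ H₀ blkZ hG.lenle 2) (weightNorm (BlockNorm.ofBlocks (toB6 g R₀ H₀) blkZ) wZ fun y => (hwZ y).le) Cop
      (fun a b => B₃ * Real.exp (-(δ₃ * g.dist a b)))) :
    HasMaj (cNorm R₀ H₀ blkZ hG.lenle 1) (weightNorm (BlockNorm.ofBlocks (toB6 g R₀ H₀) blkZ) (fun y => g.len y * wZ y) hwZ') Cop
      (fun a b => B₃' * Real.exp (-(δ₃' * g.dist a b))) := by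
  -- to the real-weight class 𝔠^{(−2)}, shift by one power, back to `cNorm … 1`
  have h2R : HasMaj (cNormR R₀ H₀ blkZ hG.lenle (-2)) (weightNorm (BlockNorm.ofBlocks (toB6 g R₀ H₀) blkZ) wZ fun y => (hwZ y).le) Cop
      (fun a b => B₃ * Real.exp (-(δ₃ * g.dist a b))) := by
    intro y' μ hμ y
    have e : (cNormR R₀ H₀ blkZ hG.lenle (-2)).loc y' μ = (cNorm R₀ H₀ blkZ hG.lenle 2).loc y' μ := by
      have h0 := cNormR_loc_neg_natCast (R₀ := R₀) (H₀ := H₀) hG blkZ 2 y' μ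
      simpa only [Nat.cast_ofNat] using h0
    rw [e]
    exact h y' μ hμ y
  have h1R := hasMaj_shift_weight_target hG hF (fun y => (hwZ y).le) hwZ' hB₃ h2R
  have h1R' : HasMaj (cNormR R₀ H₀ blkZ hG.lenle (-((1 : ℕ) : ℝ)))
      (weightNorm (BlockNorm.ofBlocks (toB6 g R₀ H₀) blkZ) (fun y => g.len y * wZ y) hwZ') Cop
      (fun a b => B₃ * L₀ * Real.exp (-((δ₃ - α * δ) * g.dist a b))) := by
    refine fun y' μ hμ y => (h1R y' μ hμ y).trans_eq ?_
    norm_num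
  have hL₀ : 0 ≤ L₀ := le_trans (le_trans zero_le_one hF.one_le_L) hF.L_le
  have hw1 := hasMaj_weaken hG (mul_nonneg hB₃ hL₀) hB' hδ' h1R'
  intro y' μ hμ y
  have hb := hw1 y' μ hμ y
  rw [cNormR_loc_neg_natCast hG] at hb
  exact hb

/-! ## §2 The class letter read as a plain two-variable sup kernel; the block-L² `c1` by Schur -/

/-- ★ **A CLASS MAJORANT `𝔠⁽ᵖ⁾ → Z_{W}` IS THE PLAIN [4]-(2.51) SUP KERNEL `K(y,y′)·W(y)⁻¹·(L^{j′}η)^{−p}`** (two block arguments, no transfer, no loss):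
`W(y)·sup_{Δ(y)}|Tμ| ≤ K(y,y′)·(L^{j′}η)^{−p}·sup|μ|` for `supp μ ⊂ Δ(y′)` solved for the sup.  (dag-n06-w8's
`B9SupLettersFromClassLetters.hasMajorantHom_of_hasMaj_cNorm_weightNorm` is the one-variable form after a p. 398 transfer.)
[cite: Balaban1984PropagatorsII, (2.51) p.232; Balaban1985BackgroundPropagators, (3.42) p.397, (3.132) p.422] -/
theorem hasMajorantHom_raw_of_hasMaj_cNorm_weightNorm (hG : GeoOK g) {blkV : V → g.Site} {blk : X → g.Site}
    {T : (V → ℝ) →ₗ[ℝ] (X → ℝ)} {K : g.Site → g.Site → ℝ} (hK : ∀ a b, 0 ≤ K a b) {p : ℕ}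
    {W : g.Site → ℝ} (hW : ∀ y, 0 < W y)
    (h : HasMaj (cNorm R₀ H₀ blkV hG.lenle p) (weightNorm (BlockNorm.ofBlocks (toB6 g R₀ H₀) blk) W fun y => (hW y).le) T K) :
    HasMajorantHom (g := toB6 g R₀ H₀) blkV blk T (fun a b => K a b * ((W a)⁻¹ * (g.len b ^ p)⁻¹)) := by
  intro y' μ B' hμ x
  have hloc : (cNorm R₀ H₀ blkV hG.lenle p).IsLoc y' μ := fun v hv => hμ.off v hv
  have hb := h y' μ hloc (blk x)
  simp only [cNorm, weightNorm_loc] at hb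
  have hWx : 0 < W (blk x) := hW (blk x)
  have h1 : |T μ x| ≤ (BlockNorm.ofBlocks (toB6 g R₀ H₀) blk).loc (blk x) (T μ) :=
    abs_apply_le_ofBlocks_loc (G := toB6 g R₀ H₀) blk (blk x) (T μ) x rfl
  have h2 : (BlockNorm.ofBlocks (toB6 g R₀ H₀) blkV).loc y' μ ≤ B' :=
    ofBlocks_loc_le_of_blockSupp (G := toB6 g R₀ H₀) blkV hμ
  have h3 : (BlockNorm.ofBlocks (toB6 g R₀ H₀) blk).loc (blk x) (T μ) ≤ (W (blk x))⁻¹ * (K (blk x) y' * (wt g p y' * B')) := by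
    rw [le_inv_mul_iff₀ hWx]
    exact hb.trans (mul_le_mul_of_nonneg_left (mul_le_mul_of_nonneg_left h2 (wt_nonneg hG.lenle p y')) (hK _ _))
  calc |T μ x| ≤ (W (blk x))⁻¹ * (K (blk x) y' * (wt g p y' * B')) := h1.trans h3
    _ = K (blk x) y' * ((W (blk x))⁻¹ * (g.len y' ^ p)⁻¹) * B' := by simp only [wt]; ring

omit [Fintype X] in
/-- ★★ **THE BLOCK-L² FIELD `Letters313L2PZ(c).c1` FROM THE SUP FIELD `.c1_2` BY SCHUR's TEST**: `C₁ : 𝔠_Z⁽²⁾ → Z_{wZ}` with `B₃·e^{−δ₃d}` and the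
counting self-transpose `IsTransposePair C₁ C₁` ([B9] p. 391: the L² adjoint; (QG₁Q\*)⁻¹ is symmetric) give `‖1_{Δ(y)}C₁μ‖₂ ≤
B₃·(√wZ_y·Lʲη)⁻¹·(√wZ_{y′}·L^{j′}η)⁻¹·e^{−δ₃d(y,y′)}‖μ‖₂` for `supp μ ⊂ Δ(y′)` — the schema field VERBATIM at `vZ = √wZ` (the knit's `vZ = √(n⁻¹)`), SAME
constant, SAME rate: `√(K(y,y′)K(y′,y))` for the raw kernel `K(y,y′) = B₃e^{−δ₃d}·wZ(y)⁻¹·(L^{j′}η)⁻²` (`B9RWSums346Schur.blockBd_schur`).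
[cite: Balaban1985BackgroundPropagators, (3.46) p.398 + (3.132) p.422 + p.391 (the L² adjoints) + Thm 3.13 p.426; Balaban1984PropagatorsII, (2.51) p.232; Schur's test, folklore] -/
theorem c1_l2_of_c1_2 (hG : GeoOK g) {blkZ : Z → g.Site} {Cop : Module.End ℝ (Z → ℝ)} {B₃ δ₃ : ℝ} (hB₃ : 0 ≤ B₃)
    {wZ : g.Site → ℝ} (hwZ : ∀ y, 0 < wZ y)
    (h : HasMaj (cNorm R₀ H₀ blkZ hG.lenle 2) (weightNorm (BlockNorm.ofBlocks (toB6 g R₀ H₀) blkZ) wZ fun y => (hwZ y).le) Cop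
      (fun a b => B₃ * Real.exp (-(δ₃ * g.dist a b))))
    (hT : IsTransposePair Cop Cop) :
    BlockBd (g := toB6 g R₀ H₀) blkZ blkZ Cop
      (fun y y' => B₃ * (Real.sqrt (wZ y) * g.len y)⁻¹ * (Real.sqrt (wZ y') * g.len y')⁻¹ * Real.exp (-(δ₃ * g.dist y y'))) := by
  have hK : ∀ a b : g.Site, 0 ≤ B₃ * Real.exp (-(δ₃ * g.dist a b)) := fun a b => mul_nonneg hB₃ (Real.exp_nonneg _)
  have hraw := hasMajorantHom_raw_of_hasMaj_cNorm_weightNorm (R₀ := R₀) (H₀ := H₀) hG hK hwZ h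
  have hKr : ∀ a b : g.Site, 0 ≤ B₃ * Real.exp (-(δ₃ * g.dist a b)) * ((wZ a)⁻¹ * (g.len b ^ 2)⁻¹) := fun a b =>
    mul_nonneg (hK a b) (mul_nonneg (inv_nonneg.mpr (hwZ a).le) (inv_nonneg.mpr (pow_nonneg (hG.lenle b) 2)))
  have hS := blockBd_schur (G := toB6 g R₀ H₀) blkZ blkZ hKr hKr hraw hraw hT
  refine hS.mono fun y y' => le_of_eq ?_
  show Real.sqrt (B₃ * Real.exp (-(δ₃ * g.dist y y')) * ((wZ y)⁻¹ * (g.len y' ^ 2)⁻¹) *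
      (B₃ * Real.exp (-(δ₃ * g.dist y' y)) * ((wZ y')⁻¹ * (g.len y ^ 2)⁻¹))) = _
  rw [hG.symm y' y]
  have ht0 : 0 ≤ B₃ * (Real.sqrt (wZ y) * g.len y)⁻¹ * (Real.sqrt (wZ y') * g.len y')⁻¹ * Real.exp (-(δ₃ * g.dist y y')) :=
    mul_nonneg (mul_nonneg (mul_nonneg hB₃ (inv_nonneg.mpr (mul_nonneg (Real.sqrt_nonneg _) (hG.lenle y))))
      (inv_nonneg.mpr (mul_nonneg (Real.sqrt_nonneg _) (hG.lenle y')))) (Real.exp_nonneg _)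
  rw [← Real.sqrt_sq ht0]
  congr 1
  simp only [mul_pow, inv_pow, Real.sq_sqrt (hwZ y).le, Real.sq_sqrt (hwZ y').le]
  ring

end Schema

/-! ## §3 node00-def-Y's model `C1coK` is its own counting-transpose; the two fields at the pins -/

section Dictionary

variable {N : ℕ} {d ℓ : ℕ} {hd : 1 ≤ d + 1} {hL : Odd (ℓ + 1) ∧ 1 < ℓ + 1} {b₀ b₁ : ℝ}
variable (i : KIdx d ℓ hd hL b₀ b₁) (B : B9.Backgrounds) (cfg : B.Cfg → CfgY (Matrix (Fin N) (Fin N) ℂ) i)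
  (parS : SiteParY (Matrix (Fin N) (Fin N) ℂ) i) (Gp : SiteOpY (Matrix (Fin N) (Fin N) ℂ) i) (Δ2 : BondOpY (Matrix (Fin N) (Fin N) ℂ) i)

/-- ★ **THE MODEL OF `C₁ = (QG₁Q\*)⁻¹` IS ITS OWN COUNTING-TRANSPOSE** at a `G`-valued configuration (`G ≦ U(N)`), taxicab transporters `parBY` and a
trace-symmetric `G₁(U)` (`IsSymmTr 1 (G1Y … U)` — e.g. def-Y's `G1Y_isSymmTr_parSymY` at the symmetrised tables and a symmetric residual `Δ⁽²⁾(U)`): `Q\*`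
is the trace-adjoint of `Q` (`isAdjTr_QY_QsY_parBY`), so `QG₁Q\*` and its `Ring.inverse` are trace-symmetric (def-Y `QGQinvOfY_isSymmTr`;
`QG1QinvY = QGQinvOfY … (G1Y …)` by definition), and an orthonormal real basis turns trace-symmetry into counting-transposition
(`isTransposePair_coordOpK_of_isSymmTr`).  Twin of dag-n06-w8's `B9Eq3126HTransposeCoords.isTransposePair_CcoK`.
[cite: Balaban1985BackgroundPropagators, (3.132) p.422, (3.128)–(3.129) p.421, p.393 (Q* the adjoint of Q), Thm 3.11 p.416 («symmetric»); Balaban1984PropagatorsII, (2.51) p.232] -/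
theorem isTransposePair_C1coK {G : Subgroup (Matrix (Fin N) (Fin N) ℂ)ˣ} (hG : G ≤ B7Prop2Explicit.unitaryUnits (Matrix (Fin N) (Fin N) ℂ))
    (U₁ : B.Cfg) (hU : ∀ μ x, cfg U₁ μ x ∈ G) (hG1 : IsSymmTr (fun _ => (1 : ℝ)) (G1Y i parS (parBY i) Gp Δ2 (cfg U₁))) :
    IsTransposePair (C1coK i (trBasis N) B cfg parS (parBY i) Gp Δ2 U₁) (C1coK i (trBasis N) B cfg parS (parBY i) Gp Δ2 U₁) := by
  have hC : IsSymmTr (fun _ => (1 : ℝ)) (QG1QinvY i parS (parBY i) Gp Δ2 (cfg U₁)) :=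
    QGQinvOfY_isSymmTr i (parBY i) (cfg U₁) _ (isAdjTr_QY_QsY_parBY i hG (cfg U₁) hU) hG1
  unfold C1coK
  exact isTransposePair_smul (isTransposePair_coordOpK_of_isSymmTr (trBasis N) (trBasis_repr_eq_trace N) _ hC) _

end Dictionary

section Pins

variable {d ℓ : ℕ} {hd : 1 ≤ d + 1} {hL : Odd (ℓ + 1) ∧ 1 < ℓ + 1} {b₀ b₁ : ℝ} {Mstar : ℕ} {N : ℕ}
variable [∀ x : MemberY d ℓ hd hL b₀ b₁ Mstar, Fintype (geo9Y x).Site]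

/-- ★★ **THE BLOCK-L² FIELD `Letters313L2PZ(c).c1` AT THE PINS, FROM THE SUP FIELD `c1_2`** — every member, every `SU(N)`-valued `U`: with `𝔬.C1 U` pinned to
def-Y's `C1coK` over the symmetrised tables and `G′ = GpPhysY` (`hC1` = the certificate's `hC1co12`; any residual `Δ⁽²⁾` symmetric at `U` — the
certificate's `hΔ2`; any coarse block map `𝔬.blkZ`), the field `c1_2` (HYPOTHESIS — `LettersHZ.c12` ∕ `Letters313Z(c).c1_2` at the weight `n⁻¹`) gives the block-L² field at
`vZ = √(n⁻¹)` with the SAME constant and rate (`c1_l2_of_c1_2` + `isTransposePair_C1coK`).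
[cite: Balaban1985BackgroundPropagators, (3.46) p.398 + (3.132) p.422 + p.391 + Thm 3.13 p.426 + (3.35) p.396; Balaban1984PropagatorsII, (2.51) p.232] -/
theorem c1_l2_pins (x : MemberY d ℓ hd hL b₀ b₁ Mstar) {X Y W : Type} [Fintype X] [Fintype Y] [Fintype W]
    {𝔬 : Ops (geo9Y x) (bg9Y (Matrix (Fin N) (Fin N) ℂ) (specialUnitaryUnits (Fin N)) x) X Y (XHK (TrIdx N) x.toKIdx) W}
    {H : Prop} {B₃ δ₃ : ℝ} (hB₃ : 0 ≤ B₃) {Δ2 : BondOpY (Matrix (Fin N) (Fin N) ℂ) x.toKIdx}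
    {U : (bg9Y (Matrix (Fin N) (Fin N) ℂ) (specialUnitaryUnits (Fin N)) x).Cfg}
    (hU : ∀ μ z, U μ z ∈ specialUnitaryUnits (Fin N)) (hΔ2 : IsSymmTr (fun _ => (1 : ℝ)) (Δ2 U))
    (hC1 : 𝔬.C1 U = C1coK x.toKIdx (trBasis N) (bg9Y (Matrix (Fin N) (Fin N) ℂ) (specialUnitaryUnits (Fin N)) x) (fun U => U)
      (parSymY x.toKIdx) (parBY x.toKIdx) (GpPhysY x.toKIdx (parSymY x.toKIdx)) Δ2 U)
    (hpl : ∀ y : (geo9Y x).Site, 0 < ((((ℓ + 1 : ℕ) : ℝ) ^ (d + 1)) ^ lvl x.hN x.D x.hk y)⁻¹)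
    (h : HasMaj (cNorm 1 H 𝔬.blkZ (fun y => (geo9Y_len_pos x y).le) 2)
      (weightNorm (BlockNorm.ofBlocks (toB6 (geo9Y x) 1 H) 𝔬.blkZ) (fun y => ((((ℓ + 1 : ℕ) : ℝ) ^ (d + 1)) ^ lvl x.hN x.D x.hk y)⁻¹)
        fun y => (hpl y).le) (𝔬.C1 U)
      (fun a b => B₃ * Real.exp (-(δ₃ * (geo9Y x).dist a b)))) :
    BlockBd (g := toB6 (geo9Y x) 1 H) 𝔬.blkZ 𝔬.blkZ (𝔬.C1 U)
      (fun y y' => B₃ * (Real.sqrt ((((ℓ + 1 : ℕ) : ℝ) ^ (d + 1)) ^ lvl x.hN x.D x.hk y)⁻¹ * (geo9Y x).len y)⁻¹ *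
        (Real.sqrt ((((ℓ + 1 : ℕ) : ℝ) ^ (d + 1)) ^ lvl x.hN x.D x.hk y')⁻¹ * (geo9Y x).len y')⁻¹ * Real.exp (-(δ₃ * (geo9Y x).dist y y'))) := by
  letI : Fintype (geo9K x.toKIdx).Site := (inferInstance : Fintype (geo9Y x).Site)
  have hG : GeoOK (geo9Y x) := ⟨geo9Y_dist_triangle x, geo9Y_dist_comm x, geo9K_dist_nonneg x.toKIdx, geo9Y_len_pos x⟩
  have hG1 : IsSymmTr (fun _ => (1 : ℝ)) (G1Y x.toKIdx (parSymY x.toKIdx) (parBY x.toKIdx) (GpPhysY x.toKIdx (parSymY x.toKIdx)) Δ2 U) :=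
    G1Y_GpPhysY_isSymmTr_parSymY x.toKIdx (specialUnitaryUnits_le_unitaryUnits (n := Fin N)) hU Δ2 hΔ2
  have hT' := isTransposePair_C1coK x.toKIdx (bg9Y (Matrix (Fin N) (Fin N) ℂ) (specialUnitaryUnits (Fin N)) x) (fun U => U)
    (parSymY x.toKIdx) (GpPhysY x.toKIdx (parSymY x.toKIdx)) Δ2 (specialUnitaryUnits_le_unitaryUnits (n := Fin N)) U hU hG1
  have hT : IsTransposePair (𝔬.C1 U) (𝔬.C1 U) := by rw [hC1]; exact hT'
  exact c1_l2_of_c1_2 (R₀ := (1 : ℝ)) (H₀ := H) hG hB₃ hpl h hT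

end Pins

/-! ## §4 The (3.132) class letters `c2 ∕ c12` AT THE PINS from row 26's `ν`-reading (dag-n06-i's bridge `B9Eq3132ClassLetterFromNu`) -/

section Nu

variable {d ℓ : ℕ} {hd : 1 ≤ d + 1} {hL : Odd (ℓ + 1) ∧ 1 < ℓ + 1} {b₀ b₁ : ℝ} {Mstar : ℕ} {N : ℕ}
variable [∀ x : MemberY d ℓ hd hL b₀ b₁ Mstar, Fintype (geo9Y x).Site]

/-- dag-n06-i's constant `|c|·M₂·S_b·C·L²` at `c = cR39 (trBasis N) ≥ 0`, `M₂ = coordBound39`, `S_b = basisBound39`, `L = ℓ+1` is below any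
`B₃ ≥ cR39·coordBound39·basisBound39·C·(ℓ+1)²`. [cite: Balaban1985BackgroundPropagators, (3.132) p.422, p.389 (dictionary), bookkeeping] -/
theorem const3132_le {C B₃ : ℝ}
    (hB₃ : cR39 (trBasis N) * (coordBound39 (trBasis N) * basisBound39 (trBasis N)) * C * (((ℓ + 1 : ℕ) : ℝ)) ^ 2 ≤ B₃) :
    |cR39 (trBasis N)| * (coordBound39 (trBasis N) * ∑ a, ‖trBasis N a‖) * C * (((ℓ + 1 : ℕ) : ℝ)) ^ 2 ≤ B₃ := by
  rw [abs_of_nonneg (cR39_nonneg (trBasis N))]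
  exact hB₃

/-- ★★ **`LettersHZ.c2` AT THE PINS FROM ROW 26's (3.132) KERNEL FOR `C = (QGQ\*)⁻¹`** — every member above the transfer threshold
`2·log L ≤ (δ₁ − δ₃)·(2L² − 1)·M`, every `U`: with `𝔬.C U` pinned to node00-def-Y's `CcoK` over the symmetrised tables and `G′ = GpPhysY` (`hC`, the
certificate's `hCco12`) and `𝔬.blkZ = blkHK` (`hblkZ`, the certificate's `hblkZ12`), the per-member conjunct `Ineq3132 (d+1) kerν C δ₁ U` of row 26's
`B9.Stmt3132Printed` for the `ν`-read kernel of `(QGQ\*)⁻¹[G′_phys]` (`h26` — HYPOTHESIS, row 26's content; at the certificate's instance of record it is the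
first conjunct by def-Y's `opsYNuOfRecordV4PE_QGQinv_QG1Qinv`, `rfl`) gives the class letter `C : 𝔠_Z⁽²⁾ → Z_{n⁻¹}` with `B₃·e^{−δ₃d}` for any `δ₃ < δ₁` and any
`B₃ ≥ cR39·coordBound39·basisBound39·C·(ℓ+1)²` — dag-n06-i's `hasMaj_cNorm_weightNorm_coordOpK_geo9Y_of_ineq3132Nu` at `b := trBasis N`, `c := cR39 b`,
`O := QGQinvY …`, read through the pins.
[cite: Balaban1985BackgroundPropagators, (3.132) p.422 + (3.123) p.420 + (3.42) p.397 + p.398 (remark after (3.47)); Balaban1984PropagatorsII, (2.51) p.232 + Lemma 2.1 (2.60) p.234] -/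
theorem c2_pins (x : MemberY d ℓ hd hL b₀ b₁ Mstar) {X Y W : Type} [Fintype X] [Fintype Y] [Fintype W]
    {𝔬 : Ops (geo9Y x) (bg9Y (Matrix (Fin N) (Fin N) ℂ) (specialUnitaryUnits (Fin N)) x) X Y (XHK (TrIdx N) x.toKIdx) W}
    {H : Prop} {U : (bg9Y (Matrix (Fin N) (Fin N) ℂ) (specialUnitaryUnits (Fin N)) x).Cfg} {C δ₁ δ₃ B₃ : ℝ} (hC : 0 ≤ C) (hδ : δ₃ < δ₁)
    (hM : 2 * Real.log (((ℓ + 1 : ℕ) : ℝ)) ≤ (δ₁ - δ₃) * (2 * ((ℓ : ℝ) + 1) ^ 2 - 1) * (geo9Y x).M)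
    (hB₃ : cR39 (trBasis N) * (coordBound39 (trBasis N) * basisBound39 (trBasis N)) * C * (((ℓ + 1 : ℕ) : ℝ)) ^ 2 ≤ B₃)
    (hblkZ : 𝔬.blkZ = blkHK x.toKIdx)
    (hCop : 𝔬.C U = CcoK x.toKIdx (trBasis N) (bg9Y (Matrix (Fin N) (Fin N) ℂ) (specialUnitaryUnits (Fin N)) x) (fun U => U)
      (parSymY x.toKIdx) (parBY x.toKIdx) (GpPhysY x.toKIdx (parSymY x.toKIdx)) U)
    (hpl : ∀ y : (geo9Y x).Site, 0 ≤ ((((ℓ + 1 : ℕ) : ℝ) ^ (d + 1)) ^ lvl x.hN x.D x.hk y)⁻¹)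
    (h26 : B9.Ineq3132 (d + 1)
      (siteKernelOfOpNu x.toKIdx (bg9Y (Matrix (Fin N) (Fin N) ℂ) (specialUnitaryUnits (Fin N)) x) (fun U => U) (nuY (d + 1) x.toKIdx)
        (QGQinvY x.toKIdx (parSymY x.toKIdx) (parBY x.toKIdx) (GpPhysY x.toKIdx (parSymY x.toKIdx)))) C δ₁ U) :
    HasMaj (cNorm 1 H 𝔬.blkZ (fun y => (geo9Y_len_pos x y).le) 2)
      (weightNorm (BlockNorm.ofBlocks (toB6 (geo9Y x) 1 H) 𝔬.blkZ) (fun y => ((((ℓ + 1 : ℕ) : ℝ) ^ (d + 1)) ^ lvl x.hN x.D x.hk y)⁻¹) hpl)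
      (𝔬.C U) (fun a b => B₃ * Real.exp (-(δ₃ * (geo9Y x).dist a b))) := by
  have h := hasMaj_cNorm_weightNorm_coordOpK_geo9Y_of_ineq3132Nu (trBasis N) x
    (bg9Y (Matrix (Fin N) (Fin N) ℂ) (specialUnitaryUnits (Fin N)) x) (fun U => U)
    (QGQinvY x.toKIdx (parSymY x.toKIdx) (parBY x.toKIdx) (GpPhysY x.toKIdx (parSymY x.toKIdx)))
    (norm_nonneg _) (abs_repr_le (trBasis N)) 1 H (cR39 (trBasis N)) U (fun y => (geo9Y_len_pos x y).le) hpl hC hδ hM h26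
  rw [hblkZ, hCop]
  exact h.mono fun a b' => mul_le_mul_of_nonneg_right (const3132_le hB₃) (Real.exp_nonneg _)

/-- ★★ **`LettersHZ.c12` = `Letters313Z(c).c1_2` AT THE PINS FROM ROW 26's (3.132) KERNEL FOR `C₁ = (QG₁Q\*)⁻¹`** — the same for the second conjunct of
row 26 (`h26₁`, the `ν`-read kernel of `(QG₁Q\*)⁻¹[G′_phys, Δ⁽²⁾]`) and the pin `hC1` (the certificate's `hC1co12`, residual `Δ⁽²⁾ = (𝔯 x).Δ2`).  Its
consequences `c1_1 ∕ c1` (block-L²) are §1–§3 (`c1_1_of_c1_2`, `c1_l2_pins`).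
[cite: Balaban1985BackgroundPropagators, (3.132) p.422 + (3.129) p.421 + (3.42) p.397 + p.398 (remark after (3.47)); Balaban1984PropagatorsII, (2.51) p.232 + Lemma 2.1 (2.60) p.234] -/
theorem c12_pins (x : MemberY d ℓ hd hL b₀ b₁ Mstar) {X Y W : Type} [Fintype X] [Fintype Y] [Fintype W]
    {𝔬 : Ops (geo9Y x) (bg9Y (Matrix (Fin N) (Fin N) ℂ) (specialUnitaryUnits (Fin N)) x) X Y (XHK (TrIdx N) x.toKIdx) W}
    {H : Prop} {Δ2 : BondOpY (Matrix (Fin N) (Fin N) ℂ) x.toKIdx}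
    {U : (bg9Y (Matrix (Fin N) (Fin N) ℂ) (specialUnitaryUnits (Fin N)) x).Cfg} {C δ₁ δ₃ B₃ : ℝ} (hC : 0 ≤ C) (hδ : δ₃ < δ₁)
    (hM : 2 * Real.log (((ℓ + 1 : ℕ) : ℝ)) ≤ (δ₁ - δ₃) * (2 * ((ℓ : ℝ) + 1) ^ 2 - 1) * (geo9Y x).M)
    (hB₃ : cR39 (trBasis N) * (coordBound39 (trBasis N) * basisBound39 (trBasis N)) * C * (((ℓ + 1 : ℕ) : ℝ)) ^ 2 ≤ B₃)
    (hblkZ : 𝔬.blkZ = blkHK x.toKIdx)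
    (hC1 : 𝔬.C1 U = C1coK x.toKIdx (trBasis N) (bg9Y (Matrix (Fin N) (Fin N) ℂ) (specialUnitaryUnits (Fin N)) x) (fun U => U)
      (parSymY x.toKIdx) (parBY x.toKIdx) (GpPhysY x.toKIdx (parSymY x.toKIdx)) Δ2 U)
    (hpl : ∀ y : (geo9Y x).Site, 0 ≤ ((((ℓ + 1 : ℕ) : ℝ) ^ (d + 1)) ^ lvl x.hN x.D x.hk y)⁻¹)
    (h26₁ : B9.Ineq3132 (d + 1)
      (siteKernelOfOpNu x.toKIdx (bg9Y (Matrix (Fin N) (Fin N) ℂ) (specialUnitaryUnits (Fin N)) x) (fun U => U) (nuY (d + 1) x.toKIdx)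
        (QG1QinvY x.toKIdx (parSymY x.toKIdx) (parBY x.toKIdx) (GpPhysY x.toKIdx (parSymY x.toKIdx)) Δ2)) C δ₁ U) :
    HasMaj (cNorm 1 H 𝔬.blkZ (fun y => (geo9Y_len_pos x y).le) 2)
      (weightNorm (BlockNorm.ofBlocks (toB6 (geo9Y x) 1 H) 𝔬.blkZ) (fun y => ((((ℓ + 1 : ℕ) : ℝ) ^ (d + 1)) ^ lvl x.hN x.D x.hk y)⁻¹) hpl)
      (𝔬.C1 U) (fun a b => B₃ * Real.exp (-(δ₃ * (geo9Y x).dist a b))) := by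
  have h := hasMaj_cNorm_weightNorm_coordOpK_geo9Y_of_ineq3132Nu (trBasis N) x
    (bg9Y (Matrix (Fin N) (Fin N) ℂ) (specialUnitaryUnits (Fin N)) x) (fun U => U)
    (QG1QinvY x.toKIdx (parSymY x.toKIdx) (parBY x.toKIdx) (GpPhysY x.toKIdx (parSymY x.toKIdx)) Δ2)
    (norm_nonneg _) (abs_repr_le (trBasis N)) 1 H (cR39 (trBasis N)) U (fun y => (geo9Y_len_pos x y).le) hpl hC hδ hM h26₁
  rw [hblkZ, hC1]
  exact h.mono fun a b' => mul_le_mul_of_nonneg_right (const3132_le hB₃) (Real.exp_nonneg _)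

/-- ★★★ **BOTH CLASS LETTERS OF `hlettersH12` FROM ROW 26 AS THE CERTIFICATE HOLDS IT** — one `obtain`: from `B9.Stmt3132Printed … (x ↦ (opsYNuOfRecordV4PE … x).QGQinv)
(x ↦ (… x).QG1Qinv)` (row 26's conclusion at the instance of record, `B9Eq3132FacesAtLetters.s3132Nu_opsYSectE_of_step12`'s output — HYPOTHESIS here, row 26's
content) there are `M₄, δ₃, a₀, B₃ > 0` such that at every member with `M₄ ≤ M`, every `0 < α₀`, `M·α₀ ≤ a₀`, every `U` in (3.35)–(3.36), the letters
`(𝔬 x).C U`, `(𝔬 x).C1 U` pinned to def-Y's `CcoK ∕ C1coK` fed `G′_phys` and the residual `(𝔯 x).Δ2` (`hC ∕ hC1`, the certificate's `hCco12 ∕ hC1co12`) on the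
coarse blocks `blkHK` (`hblkZ`) carry `LettersHZ.c2` and `LettersHZ.c12` (= `Letters313Z(c).c1_2`) at the weight `n⁻¹`, constant `B₃`, rate `δ₃`:
dag-n06-i's `hasMaj_cNorm_weightNorm_coordOpK_of_stmt3132Nu` at `T := QGQinvY …`, `T₁ := QG1QinvY … (𝔯 x).Δ2` (the instance's kernels by
def-Y's `opsYNuOfRecordV4PE_QGQinv_QG1Qinv`, `rfl`), read through the pins.  The rate `δ₃` is PRODUCED (half of row 26's hidden `δ₁`), not prescribed.
[cite: Balaban1985BackgroundPropagators, (3.132) p.422 (statement before Thm 3.12) + (3.123) p.420 + (3.129) p.421 + p.398 (remark after (3.47)); Balaban1984PropagatorsII, (2.51) p.232 + Lemma 2.1 (2.60) p.234] -/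
theorem c2_c12_pins_of_row26 {θ : Stage3Params} {Mstar : ℕ} [∀ x : MemberY θ.d₆ θ.ℓ₆ θ.hd' θ.hL' θ.b₀ θ.b₁ Mstar, Fintype (geo9Y x).Site]
    (𝔯 : ResY N θ Mstar) (𝔢 : SectEY N θ Mstar) (𝔴 : RWEY N θ Mstar) (𝔈 : ExpsY N θ Mstar)
    {X Y W : MemberY θ.d₆ θ.ℓ₆ θ.hd' θ.hL' θ.b₀ θ.b₁ Mstar → Type} [∀ x, Fintype (X x)] [∀ x, Fintype (Y x)] [∀ x, Fintype (W x)]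
    (𝔬 : ∀ x : MemberY θ.d₆ θ.ℓ₆ θ.hd' θ.hL' θ.b₀ θ.b₁ Mstar,
      Ops (geo9Y x) (bg9Y (Matrix (Fin N) (Fin N) ℂ) (specialUnitaryUnits (Fin N)) x) (X x) (Y x) (XHK (TrIdx N) x.toKIdx) (W x))
    (H : MemberY θ.d₆ θ.ℓ₆ θ.hd' θ.hL' θ.b₀ θ.b₁ Mstar → Prop) {c35 : ℝ}
    (hblkZ : ∀ x, (𝔬 x).blkZ = blkHK x.toKIdx)
    (hC : ∀ x U, (𝔬 x).C U = CcoK x.toKIdx (trBasis N) (bg9Y (Matrix (Fin N) (Fin N) ℂ) (specialUnitaryUnits (Fin N)) x) (fun U => U)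
      (parSymY x.toKIdx) (parBY x.toKIdx) (GpPhysY x.toKIdx (parSymY x.toKIdx)) U)
    (hC1 : ∀ x U, (𝔬 x).C1 U = C1coK x.toKIdx (trBasis N) (bg9Y (Matrix (Fin N) (Fin N) ℂ) (specialUnitaryUnits (Fin N)) x) (fun U => U)
      (parSymY x.toKIdx) (parBY x.toKIdx) (GpPhysY x.toKIdx (parSymY x.toKIdx)) (𝔯 x).Δ2 U)
    (hpl : ∀ (x : MemberY θ.d₆ θ.ℓ₆ θ.hd' θ.hL' θ.b₀ θ.b₁ Mstar) (y : (geo9Y x).Site),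
      0 ≤ ((((θ.ℓ₆ + 1 : ℕ) : ℝ) ^ (θ.d₆ + 1)) ^ lvl x.hN x.D x.hk y)⁻¹)
    (h26 : B9.Stmt3132Printed (θ.d₆ + 1) c35
      (geo9Y (d := θ.d₆) (ℓ := θ.ℓ₆) (hd := θ.hd') (hL := θ.hL') (b₀ := θ.b₀) (b₁ := θ.b₁) (Mstar := Mstar))
      (bg9Y (Matrix (Fin N) (Fin N) ℂ) (specialUnitaryUnits (Fin N)))
      (fun x => (opsYNuOfRecordV4PE N θ Mstar 𝔯 𝔢 𝔴 𝔈 x).QGQinv) (fun x => (opsYNuOfRecordV4PE N θ Mstar 𝔯 𝔢 𝔴 𝔈 x).QG1Qinv)) :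
    ∃ M₄ δ₃ a₀ B₃ : ℝ, 0 < M₄ ∧ 0 < δ₃ ∧ 0 < a₀ ∧ 0 < B₃ ∧
      ∀ x : MemberY θ.d₆ θ.ℓ₆ θ.hd' θ.hL' θ.b₀ θ.b₁ Mstar, M₄ ≤ (geo9Y x).M → ∀ α₀ : ℝ, 0 < α₀ → (geo9Y x).M * α₀ ≤ a₀ →
        ∀ U : (bg9Y (Matrix (Fin N) (Fin N) ℂ) (specialUnitaryUnits (Fin N)) x).Cfg,
          (bg9Y (Matrix (Fin N) (Fin N) ℂ) (specialUnitaryUnits (Fin N)) x).Reg335 c35 α₀ U →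
          (bg9Y (Matrix (Fin N) (Fin N) ℂ) (specialUnitaryUnits (Fin N)) x).Reg336 c35 α₀ U →
            HasMaj (cNorm 1 (H x) (𝔬 x).blkZ (fun y => (geo9Y_len_pos x y).le) 2)
                (weightNorm (BlockNorm.ofBlocks (toB6 (geo9Y x) 1 (H x)) (𝔬 x).blkZ)
                  (fun y => ((((θ.ℓ₆ + 1 : ℕ) : ℝ) ^ (θ.d₆ + 1)) ^ lvl x.hN x.D x.hk y)⁻¹) (hpl x))
                ((𝔬 x).C U) (fun a b => B₃ * Real.exp (-(δ₃ * (geo9Y x).dist a b))) ∧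
              HasMaj (cNorm 1 (H x) (𝔬 x).blkZ (fun y => (geo9Y_len_pos x y).le) 2)
                (weightNorm (BlockNorm.ofBlocks (toB6 (geo9Y x) 1 (H x)) (𝔬 x).blkZ)
                  (fun y => ((((θ.ℓ₆ + 1 : ℕ) : ℝ) ^ (θ.d₆ + 1)) ^ lvl x.hN x.D x.hk y)⁻¹) (hpl x))
                ((𝔬 x).C1 U) (fun a b => B₃ * Real.exp (-(δ₃ * (geo9Y x).dist a b))) := by
  obtain ⟨M₄, δ₃, a₀, B₃, hM₄, hδ₃, ha₀, hB₃, hall⟩ :=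
    hasMaj_cNorm_weightNorm_coordOpK_of_stmt3132Nu (trBasis N) (specialUnitaryUnits (Fin N))
      (fun x => QGQinvY x.toKIdx (parSymY x.toKIdx) (parBY x.toKIdx) (GpPhysY x.toKIdx (parSymY x.toKIdx)))
      (fun x => QG1QinvY x.toKIdx (parSymY x.toKIdx) (parBY x.toKIdx) (GpPhysY x.toKIdx (parSymY x.toKIdx)) (𝔯 x).Δ2)
      (norm_nonneg _) (abs_repr_le (trBasis N)) (fun _ => (1 : ℝ)) H (cR39 (trBasis N)) (fun x y => (geo9Y_len_pos x y).le) hpl h26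
  refine ⟨M₄, δ₃, a₀, B₃, hM₄, hδ₃, ha₀, hB₃, fun x hM α₀ hα ha U hU hU' => ?_⟩
  rw [hblkZ x, hC x U, hC1 x U]
  exact hall x hM α₀ hα ha U hU hU'

end Nu

end Literature.MathematicalPhysics.QuantumFieldTheory.Balaban1983to89.B9LettersZCFieldsAtPins

end
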